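/-
Copyright (c) 2026. All rights reserved.
Released under Apache 2.0 license as described in the file LICENSE.
Authors: abc-iut cell, prover seat abc-iut-w5-d144 (gen 6; row «IDRIGID-COVER-INHERITANCE», `HolRS` half), over the
lineage's `ArchimedeanHolFieldFunctorGeometricGaloisDescent` (gen 4), `…TorusMinusFiniteOuter` (gen 5),
`…PuncturedEllipticOuter` (gen 4), abc-iut-L4-t12's `IdRigidMapsToFullSubcategory` / `…PlaneComplTwist`,
abc-iut-f-072's `CovFin.galoisCategory` and Mathlib's Galois categories.
-/
import Literature.AnabelianGeometry.AbsoluteAnabelian.IdRigidMapsToGaloisExtension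
import Literature.AnabelianGeometry.AbsoluteAnabelian.ArchimedeanHolFieldFunctorGeometricGaloisDescent
import Literature.AnabelianGeometry.AbsoluteAnabelian.ArchimedeanHolFieldFunctorGeometricTorusMinusFiniteOuter
import Literature.AnabelianGeometry.AbsoluteAnabelian.ArchimedeanHolFieldFunctorGeometricPuncturedEllipticOuter
import Literature.AnabelianGeometry.AbsoluteAnabelian.IdRigidMapsToFullSubcategory
import HarnessLib

/-!
# [AbsTopIII] Prop 4.2 (i) at the geometric model: id-rigidity of «objects of `EA` mapping to `𝕏`» is INHERITED
# by every finite étale cover `𝕏' → 𝕏` — Galois descent in `HolRS` (row «IDRIGID-COVER-INHERITANCE»)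

S. Mochizuki, *Topics in Absolute Anabelian Geometry III*, proof of Prop 4.2 (i), kurims p.106 l.11–19: «for any
object `X ∈ Ob(EA)` … the full subcategory of `EA` consisting of objects that map to `X` … [is id-rigid]».
[cite: MochizukiAbsTopIII2015, Proposition 4.2 (i) p.106]

PROOF-ONLY file (abc-iut cell, campaign-L item R1.2 of the geometric `EA` column; seat abc-iut-w5-d144 gen 6).
The cell's model column proves this id-rigidity UNCONDITIONALLY at the bases of type `(0, r ≥ 3)` (`ℂ ∖ F`,
abc-iut-L4-t12) and `(1, r ≥ 1)` (`E ∖ S`, this lineage's (OUT) route), and at uniformised bases `ℍ/Γ̄` modulo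
covolume data.  Id-rigidity (`Aut 𝟭 = 1`) is NOT inherited by full subcategories for free; here it is pushed UP
along every morphism `p : 𝕏' → 𝕏` of `HolRS` by the EXTENSION argument of `isIdRigid_mapsTo_of_galois_descent`
(file `IdRigidMapsToGaloisExtension`): an automorphism of `𝟭` on «mapsTo `𝕏'`» extends to «mapsTo `𝕏`» by
descending its components along GALOIS coverings of `𝕏`.  Contents:

* §1 (manifolds) `mdifferentiableAt_of_comp_eq_of_isLocalDiffeomorphAt` — differentiability DESCENDS along a local
  diffeomorphism (`g ∘ q = t`, `t` differentiable ⇒ `g` differentiable at `q b`).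
* §2 (`HolRS`) `mdifferentiable_of_comp_hom_eq`; `exists_iso_comp_eq_of_forall_comm` — **Galois descent of
  automorphisms**: along `q : B → W` whose relative endomorphisms are transitive on the fibres, every automorphism
  of `B` commuting with `End B` descends to an automorphism of `W`.
* §3 (`HolRS`, Galois coverings of `𝕏`) `exists_galois_over_hom_hom` (a Galois covering of `𝕏` dominating two given
  objects over `𝕏`: Mathlib's `exists_hom_from_galois_of_fiber` at a fibre point of the product in `Cov^fin(𝕏^top)`),
  `exists_overIso_hom_comp_eq` (deck transitivity on morphisms), `exists_hom_comp_eq_apply_eq_of_isGalois` (deck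
  transitivity on the fibres of an intermediate covering, via `CovFin.isGalois_iff_forall_exists_deck` and
  uniqueness of lifts).
* §4 ★ `isIdRigid_mapsTo_of_hom (p : 𝕏' ⟶ 𝕏)` — **«mapsTo `𝕏`» id-rigid ⇒ «mapsTo `𝕏'`» id-rigid.**
* §5 ★★ consequences with ZERO hypotheses: `isIdRigid_mapsTo_of_hom_of_isPuncturedEllipticCurve`,
  `…_complexTorus_compl_finite`, `…_planeComplFinite` — «objects of `EA` mapping to `𝕏'`» is id-rigid for EVERY
  connected Riemann surface `𝕏'` finite étale over a once-punctured elliptic curve / `E ∖ S` / `ℂ ∖ F` (`|F| ≥ 2`);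
  this includes punctured curves of every genus, in particular IUT's archimedean curves `X̲_v` (type `(1, l)`) and
  `X̲→_v` (type `(1, l-tors→)`, of genus `> 1`: its compactification is totally ramified at the cusp `ε′` over that
  of `X̲_v` since `I_{ε′} ⥲ Δ_ε⁺`, [IUTchI] §1 pp.37–38) of [IUTchI] Ex 3.4 (i) p.80, both finite étale over
  `X_v = E_v ∖ {0}`; the `EA^hol_RS(Q)` / [AbsTopIII] Cor 4.5 (i)–(v) forms `isIdRigid_mapsTo_fullSubcategory_of_hom`,
  `cor_4_5_geometric_mapsTo_of_hom(_of_isPuncturedEllipticCurve)`.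

HONEST SCOPE: MODEL side of [AbsTopIII] §4 (model ≠ reconstruction); orbicurves, uniformisation, Lemma 4.3
untouched; classical mathematics (SGA 1 V §4–§5, covering spaces, Riemann surfaces); no definition, no instance, no
Prop-valued fact; support library, not a node; nothing here bears on [IUTchIII] Cor. 3.12; no side taken.

## References

* S. Mochizuki, *Topics in Absolute Anabelian Geometry III*, kurims ms, §0 p.27 (id-rigid), Def 4.1 (iii) p.103,
  proof of Prop 4.2 (i) p.106 l.11–19, Cor 4.5 pp.107–109. [MochizukiAbsTopIII2015]
* S. Mochizuki, *Inter-universal Teichmüller theory I*, kurims ms (May 2020), §1 pp.37–38, Ex 3.4 (i) p.80.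
  [Mochizuki2012] (D-0012 claim key, status disputed — cited for the OBJECTS `X̲_v`, `X̲→_v` only)
* A. Grothendieck, M. Raynaud, SGA 1, Exp. V §4–§5 (Galois objects; transitivity; descent). [SGA1]
* A. Hatcher, *Algebraic Topology*, CUP 2002, §1.3 Prop. 1.34 (uniqueness of lifts), Prop. 1.39. [HatcherAT2002]
* I-Hsiung Lin, *Classical complex analysis: a geometric approach*, vol. 2 (2011), (7.5.2.1) p.449. [Lin2011]
-/

noncomputable section

open CategoryTheory CategoryTheory.PreGaloisCategory Topology Set Function Filter
open scoped Manifold ContDiff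
open Literature.Topology.CoveringSpaces
open Literature.Geometry.Kaehler
open Literature.Geometry.Kaehler.ComplexTorus (deckTransformations mem_deckTransformations_iff)

universe v u

namespace Literature.AnabelianGeometry.AbsoluteAnabelian

/-! ### §1 Manifolds: differentiability DESCENDS along a local diffeomorphism -/

section Descent

variable {𝕜 : Type*} [NontriviallyNormedField 𝕜] {E : Type*} [NormedAddCommGroup E] [NormedSpace 𝕜 E]
  {H : Type*} [TopologicalSpace H] {I : ModelWithCorners 𝕜 E H} {n : WithTop ℕ∞}
  {M : Type*} [TopologicalSpace M] [ChartedSpace H M]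
  {N : Type*} [TopologicalSpace N] [ChartedSpace H N]
  {P : Type*} [TopologicalSpace P] [ChartedSpace H P]
  {q : M → N} {t : M → P} {g : N → P}

/-- **Descent of differentiability along a local diffeomorphism, pointwise**: if `q` is a local
`C^n`-diffeomorphism at `b` (`n ≠ 0`), `t` is differentiable at `b` and `g ∘ q = t`, then `g` is
differentiable at `q b` — near `q b`, `g = t ∘ Φ⁻¹` for the local diffeomorphism piece `Φ` of `q` at `b`
(Lin: quotients / images of conformal structures along local conformal maps).
[cite: Lin2011, (7.5.2.1) p.449] -/
theorem mdifferentiableAt_of_comp_eq_of_isLocalDiffeomorphAt {b : M} (hn : n ≠ 0)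
    (hq : IsLocalDiffeomorphAt I I n q b) (ht : MDifferentiableAt I I t b) (h : g ∘ q = t) :
    MDifferentiableAt I I g (q b) := by
  obtain ⟨Φ, hb, heq⟩ := hq
  have hqb : q b = Φ b := heq hb
  have htgt : Φ.target ∈ 𝓝 (q b) := by
    rw [hqb]
    exact Φ.open_target.mem_nhds (Φ.toPartialEquiv.map_source hb)
  -- on `Φ.target`, `g = t ∘ Φ.symm`
  have h2 : g =ᶠ[𝓝 (q b)] t ∘ Φ.symm := by
    filter_upwards [htgt] with w hw
    have hs : Φ.toPartialEquiv.symm w ∈ Φ.source := Φ.toPartialEquiv.map_target hw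
    have h1 : q (Φ.toPartialEquiv.symm w) = w :=
      (heq hs).trans (Φ.toPartialEquiv.right_inv hw)
    have h3 := congrFun h (Φ.toPartialEquiv.symm w)
    rw [Function.comp_apply, h1] at h3
    exact h3
  refine MDifferentiableAt.congr_of_eventuallyEq ?_ h2
  have h3 : MDifferentiableAt I I Φ.symm (q b) := by
    rw [hqb]
    exact Φ.symm.mdifferentiableAt hn (Φ.toPartialEquiv.map_source hb)
  have h4 : MDifferentiableAt I I t (Φ.symm (q b)) := by
    have hsb : Φ.symm (q b) = b := by
      rw [hqb]
      exact Φ.toPartialEquiv.left_inv hb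
    rw [hsb]
    exact ht
  exact h4.comp (q b) h3

end Descent

namespace HolRS

/-! ### §2 `HolRS`: holomorphy descends along morphisms; automorphisms commuting with `End B` descend
along morphisms with transitive relative automorphisms -/

/-- **Holomorphy descends along a morphism of `HolRS`**: for `q : B → W` (a SURJECTIVE holomorphic local
biholomorphism) and any map `g` out of `W^top` into a Riemann surface with `g ∘ q` holomorphic, `g` is
holomorphic. [cite: Lin2011, (7.5.2.1) p.449] -/
theorem mdifferentiable_of_comp_hom_eq {B W Z : HolRS} (q : B ⟶ W) {g : W.carrier → Z.carrier}
    {t : B.carrier → Z.carrier} (ht : MDifferentiable 𝓘(ℂ, ℂ) 𝓘(ℂ, ℂ) t) (h : g ∘ q.toFun = t) :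
    MDifferentiable 𝓘(ℂ, ℂ) 𝓘(ℂ, ℂ) g := by
  intro w
  obtain ⟨b, rfl⟩ := Hom.surjective q w
  exact mdifferentiableAt_of_comp_eq_of_isLocalDiffeomorphAt (by decide) (q.isLocalDiffeomorph b) (ht b) h

/-- Along a morphism `q : B → W` whose relative endomorphisms (`d ≫ q = q`) are TRANSITIVE on the fibres
of `q`, an endomorphism `t` of `B` commuting with `End B` preserves the fibres of `q`:
`q b₁ = q b₂ ⇒ q (t b₁) = q (t b₂)`. [cite: SGA1, Exp. V §5] -/
theorem apply_eq_apply_of_forall_comm {B W : HolRS} (q : B ⟶ W)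
    (htrans : ∀ b₁ b₂ : B.carrier, q.toFun b₁ = q.toFun b₂ →
      ∃ d : B ⟶ B, d ≫ q = q ∧ d.toFun b₁ = b₂)
    (t : B ⟶ B) (ht : ∀ u : B ⟶ B, t ≫ u = u ≫ t) {b₁ b₂ : B.carrier}
    (hb : q.toFun b₁ = q.toFun b₂) : q.toFun (t.toFun b₁) = q.toFun (t.toFun b₂) := by
  obtain ⟨d, hdq, hd⟩ := htrans b₁ b₂ hb
  have h1 : d.toFun (t.toFun b₁) = t.toFun (d.toFun b₁) := by
    have h := congrArg Hom.toFun (ht d)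
    rw [comp_toFun, comp_toFun] at h
    exact congrFun h b₁
  calc q.toFun (t.toFun b₁) = (d ≫ q).toFun (t.toFun b₁) := by rw [hdq]
    _ = q.toFun (d.toFun (t.toFun b₁)) := rfl
    _ = q.toFun (t.toFun b₂) := by rw [h1, hd]

/-- **Galois descent of automorphisms in `HolRS`.**  Let `q : B → W` be a morphism whose relative
endomorphisms (`d : B → B` with `d ≫ q = q`) act TRANSITIVELY on every fibre of `q` (e.g. `q` a Galois
covering), and `τ` an automorphism of `B` commuting with EVERY endomorphism of `B`.  Then `τ` descends
along `q`: there is an automorphism `e` of `W` with `q ≫ e = τ ≫ q` (the descended map is well defined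
by the previous lemma, holomorphic because holomorphy descends along `q`, and bijective with inverse
the descent of `τ⁻¹`). [cite: SGA1, Exp. V §5] [cite: Lin2011, (7.5.2.1) p.449] -/
theorem exists_iso_comp_eq_of_forall_comm {B W : HolRS} (q : B ⟶ W)
    (htrans : ∀ b₁ b₂ : B.carrier, q.toFun b₁ = q.toFun b₂ →
      ∃ d : B ⟶ B, d ≫ q = q ∧ d.toFun b₁ = b₂)
    (τ : B ≅ B) (hτ : ∀ u : B ⟶ B, τ.hom ≫ u = u ≫ τ.hom) :
    ∃ e : W ≅ W, q ≫ e.hom = τ.hom ≫ q := by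
  classical
  have hsurj := Hom.surjective q
  have hτ' : ∀ u : B ⟶ B, τ.inv ≫ u = u ≫ τ.inv := fun u => by
    rw [Iso.inv_comp_eq, ← Category.assoc, hτ u, Category.assoc, Iso.hom_inv_id, Category.comp_id]
  -- the descended maps
  let g : (B ⟶ B) → W.carrier → W.carrier := fun t w => q.toFun (t.toFun (Classical.choose (hsurj w)))
  have g_spec : ∀ (t : B ⟶ B), (∀ u : B ⟶ B, t ≫ u = u ≫ t) →
      ∀ b, g t (q.toFun b) = q.toFun (t.toFun b) := fun t ht b =>
    apply_eq_apply_of_forall_comm q htrans t ht (Classical.choose_spec (hsurj (q.toFun b)))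
  have g_comp : ∀ (t : B ⟶ B), (∀ u : B ⟶ B, t ≫ u = u ≫ t) → g t ∘ q.toFun = (t ≫ q).toFun :=
    fun t ht => funext fun b => g_spec t ht b
  have g_hol : ∀ (t : B ⟶ B), (∀ u : B ⟶ B, t ≫ u = u ≫ t) →
      MDifferentiable 𝓘(ℂ, ℂ) 𝓘(ℂ, ℂ) (g t) := fun t ht =>
    mdifferentiable_of_comp_hom_eq q (t ≫ q).mdifferentiable (g_comp t ht)
  have hinv₁ : ∀ w, g τ.inv (g τ.hom w) = w := fun w => by
    obtain ⟨b, rfl⟩ := hsurj w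
    rw [g_spec τ.hom hτ, g_spec τ.inv hτ']
    show q.toFun ((τ.hom ≫ τ.inv).toFun b) = q.toFun b
    rw [Iso.hom_inv_id, id_toFun, id_eq]
  have hinv₂ : ∀ w, g τ.hom (g τ.inv w) = w := fun w => by
    obtain ⟨b, rfl⟩ := hsurj w
    rw [g_spec τ.inv hτ', g_spec τ.hom hτ]
    show q.toFun ((τ.inv ≫ τ.hom).toFun b) = q.toFun b
    rw [Iso.inv_hom_id, id_toFun, id_eq]
  let eH : W.carrier ≃ₜ W.carrier :=
    { toFun := g τ.hom
      invFun := g τ.inv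
      left_inv := hinv₁
      right_inv := hinv₂
      continuous_toFun := (g_hol τ.hom hτ).continuous
      continuous_invFun := (g_hol τ.inv hτ').continuous }
  have hfe : IsFiniteEtale (g τ.hom) := IsFiniteEtale.of_homeomorph eH
  have hfe' : IsFiniteEtale (g τ.inv) := IsFiniteEtale.of_homeomorph eH.symm
  let eHom : W ⟶ W := ⟨g τ.hom, g_hol τ.hom hτ, hfe⟩
  let eInv : W ⟶ W := ⟨g τ.inv, g_hol τ.inv hτ', hfe'⟩
  exact ⟨⟨eHom, eInv, hom_ext (funext hinv₁), hom_ext (funext hinv₂)⟩, hom_ext (g_comp τ.hom hτ)⟩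

/-! ### §3 Galois coverings of `𝕏` in `HolRS`: common Galois dominators, transitivity of the deck group
on morphisms and on fibres -/

variable (X : HolRS)

/-- **Common Galois dominator**: any two objects `𝕐₁ → 𝕏`, `𝕐₂ → 𝕏` of the slice receive morphisms over
`𝕏` from one object `ℤ → 𝕏` whose underlying finite cover is a GALOIS object of `Cov^fin(𝕏^top)`
(Mathlib's `exists_hom_from_galois_of_fiber` at a fibre point of the product `𝕐₁ × 𝕐₂` in the Galois
category `Cov^fin(𝕏^top)`, transported to the slice through abc-iut-L4-t12's essential image of
`overToCovFin` and fullness). [cite: SGA1, Exp. V §5]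
[cite: MochizukiAbsTopIII2015, proof of Proposition 4.2, p.106 l.11–19] -/
theorem exists_galois_over_hom_hom [GaloisCategory (CovFin X.carrier)] (Y₁ Y₂ : Over X) :
    ∃ Z : Over X, IsGalois (X.overToCovFin.obj Z) ∧ Nonempty (Z ⟶ Y₁) ∧ Nonempty (Z ⟶ Y₂) := by
  haveI := pathConnectedSpace_carrier X
  haveI := stronglyLocallyContractibleSpace_carrier X
  haveI := X.overToCovFin_full
  obtain ⟨x₀⟩ := (inferInstance : Nonempty X.carrier)
  let F := GaloisCategory.getFiberFunctor (CovFin X.carrier)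
  haveI : IsConnected (X.overToCovFin.obj Y₁) := X.isConnected_overToCovFin_obj _
  haveI : IsConnected (X.overToCovFin.obj Y₂) := X.isConnected_overToCovFin_obj _
  obtain ⟨e₁⟩ := nonempty_fiber_of_isConnected F (X.overToCovFin.obj Y₁)
  obtain ⟨e₂⟩ := nonempty_fiber_of_isConnected F (X.overToCovFin.obj Y₂)
  obtain ⟨A, f, -, hA, -⟩ := exists_hom_from_galois_of_fiber F
    (X.overToCovFin.obj Y₁ ⨯ X.overToCovFin.obj Y₂) ((fiberBinaryProductEquiv F _ _).symm (e₁, e₂))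
  haveI : PathConnectedSpace A.obj.left :=
    (CovFin.isConnected_iff_pathConnectedSpace x₀ A).mp hA.toIsConnected
  haveI := hA
  exact ⟨overOfCovFin A, isGalois_of_iso (overToCovFinObjIso A).symm,
    ⟨X.overToCovFin.preimage ((overToCovFinObjIso A).hom ≫ f ≫ Limits.prod.fst)⟩,
    ⟨X.overToCovFin.preimage ((overToCovFinObjIso A).hom ≫ f ≫ Limits.prod.snd)⟩⟩

/-- **Transitivity of the deck group on morphisms out of a Galois covering**: for `ℤ → 𝕏` Galois and any
`𝕐 → 𝕏`, two morphisms `ℤ → 𝕐` over `𝕏` differ by an automorphism of `ℤ` over `𝕏`.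
[cite: SGA1, Exp. V §5] -/
theorem exists_overIso_hom_comp_eq [GaloisCategory (CovFin X.carrier)] {Z Y : Over X}
    (hZ : IsGalois (X.overToCovFin.obj Z)) (f g : Z ⟶ Y) : ∃ σ : Z ≅ Z, σ.hom ≫ g = f := by
  haveI := pathConnectedSpace_carrier X
  haveI := stronglyLocallyContractibleSpace_carrier X
  haveI := X.overToCovFin_full
  haveI := X.overToCovFin_faithful
  haveI := hZ
  haveI : IsConnected (X.overToCovFin.obj Y) := X.isConnected_overToCovFin_obj _
  obtain ⟨σ', hσ'⟩ :=
    exists_iso_hom_comp_eq_of_isGalois (X.overToCovFin.map f) (X.overToCovFin.map g)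
  refine ⟨X.overToCovFin.preimageIso σ', X.overToCovFin.map_injective ?_⟩
  rw [Functor.map_comp, Functor.preimageIso_hom, Functor.map_preimage, hσ']

/-- **Transitivity of the deck group on the fibres of an intermediate covering**: for `ℤ → 𝕏` Galois and
`q : ℤ → 𝕎` over `𝕏` (`q ≫ w = (ℤ → 𝕏)`), two points of `ℤ` with the same image under `q` are exchanged
by an endomorphism `d` of `ℤ` with `d ≫ q = q` (a deck transformation over `𝕏` moving one to the other
exists by Galois-ness; it is holomorphic by rigidity, and `d ≫ q = q` by uniqueness of lifts along the
covering `w`, both sides agreeing at one point of the connected `ℤ`).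
[cite: SGA1, Exp. V §5] [cite: HatcherAT2002, §1.3 Prop. 1.34] -/
theorem exists_hom_comp_eq_apply_eq_of_isGalois [GaloisCategory (CovFin X.carrier)] {W : HolRS}
    (Z : Over X) (hZ : IsGalois (X.overToCovFin.obj Z)) (q : Z.left ⟶ W) (w : W ⟶ X)
    (hqw : q ≫ w = Z.hom) (b₁ b₂ : Z.left.carrier) (h : q.toFun b₁ = q.toFun b₂) :
    ∃ d : Z.left ⟶ Z.left, d ≫ q = q ∧ d.toFun b₁ = b₂ := by
  haveI := pathConnectedSpace_carrier X
  haveI := stronglyLocallyContractibleSpace_carrier X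
  have hwq : ∀ x, w.toFun (q.toFun x) = Z.hom.toFun x := fun x => by
    have h' := congrArg Hom.toFun hqw
    rw [comp_toFun] at h'
    exact congrFun h' x
  have hb : Z.hom.toFun b₂ = Z.hom.toFun b₁ := by rw [← hwq, ← hwq, h]
  obtain ⟨-, hdeck⟩ :=
    (CovFin.isGalois_iff_forall_exists_deck (Z.hom.toFun b₁) (X.overToCovFin.obj Z)).mp hZ
  obtain ⟨f, hf, hfb⟩ := hdeck ⟨b₁, rfl⟩ ⟨b₂, hb⟩
  rw [mem_deckTransformations_iff] at hf
  have hfb' : f b₁ = b₂ := hfb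
  refine ⟨(isoOfHomeomorphOver Z.hom Z.hom f (funext hf)).hom, hom_ext ?_, hfb'⟩
  rw [comp_toFun, isoOfHomeomorphOver_hom_toFun]
  haveI : PreconnectedSpace Z.left.carrier := Z.left.connectedSpace.toPreconnectedSpace
  refine w.isFiniteEtale.isCoveringMap.eq_of_comp_eq (A := Z.left.carrier) (g₁ := q.toFun ∘ f)
    (g₂ := q.toFun) (q.mdifferentiable.continuous.comp f.continuous) q.mdifferentiable.continuous
    (funext fun x => ?_) b₁ ?_
  · show w.toFun (q.toFun (f x)) = w.toFun (q.toFun x)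
    rw [hwq, hwq]
    exact hf x
  · show q.toFun (f b₁) = q.toFun b₁
    rw [hfb', h]

/-! ### §4 ★ Id-rigidity of «objects of `EA` mapping to `𝕏`» is inherited by every `𝕏'` finite étale
over `𝕏` -/

/-- ★ **Id-rigidity of «objects mapping to `𝕏`» is INHERITED along finite étale covers.**  For every
holomorphic finite étale map `p : 𝕏' → 𝕏` of connected Riemann surfaces: if the full subcategory of
`HolRS` on the objects mapping to `𝕏` is id-rigid ([AbsTopIII] Prop 4.2 (i) proof, p.106 l.11–19, at
`𝕏`), then so is the full subcategory on the objects mapping to `𝕏'`.  Proof: the abstract Galois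
extension `isIdRigid_mapsTo_of_galois_descent` with (E) `HolRS.epi_of_hom`, (DESC) descent of
`End`-central automorphisms along Galois coverings of `𝕏` dominating both `𝕎` and `𝕏'`, (DOM) common
Galois dominators and transitivity of their deck groups.  No hypothesis on `𝕏`, `𝕏'` beyond the
`HolRS` structure. [cite: MochizukiAbsTopIII2015, Proposition 4.2 (i) p.106] [cite: SGA1, Exp. V §5] -/
theorem isIdRigid_mapsTo_of_hom {X X' : HolRS} (p : X' ⟶ X)
    (h : IsIdRigid (ObjectProperty.FullSubcategory fun Y : HolRS => Nonempty (Y ⟶ X))) :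
    IsIdRigid (ObjectProperty.FullSubcategory fun Y : HolRS => Nonempty (Y ⟶ X')) := by
  haveI := pathConnectedSpace_carrier X
  haveI := stronglyLocallyContractibleSpace_carrier X
  haveI : GaloisCategory (CovFin X.carrier) := CovFin.galoisCategory
  refine isIdRigid_mapsTo_of_galois_descent p (fun B W _ f => epi_of_hom f) ?_ ?_ h
  · -- (DESC): a Galois covering of `𝕏` dominating `𝕎` and `𝕏'`; descent along it
    intro W hW
    obtain ⟨w⟩ := hW
    obtain ⟨Z, hZ, ⟨k⟩, ⟨s⟩⟩ := X.exists_galois_over_hom_hom (Over.mk w) (Over.mk p)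
    refine ⟨Z.left, ⟨s.left⟩, k.left, fun τ hτ => ?_⟩
    obtain ⟨e, he⟩ := exists_iso_comp_eq_of_forall_comm k.left
      (X.exists_hom_comp_eq_apply_eq_of_isGalois Z hZ k.left w (Over.w k)) τ hτ
    exact ⟨e.hom, he⟩
  · -- (DOM): a Galois covering of `𝕏` dominating `B₁`, `B₂` (over `𝕏` through `𝕎`) and `𝕏'`
    intro W B₁ B₂ hW _ _ g₁ g₂
    obtain ⟨w⟩ := hW
    obtain ⟨Z₀, -, ⟨k₁⟩, ⟨k₂⟩⟩ :=
      X.exists_galois_over_hom_hom (Over.mk (g₁ ≫ w)) (Over.mk (g₂ ≫ w))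
    obtain ⟨Z, hZ, ⟨m⟩, ⟨s⟩⟩ := X.exists_galois_over_hom_hom Z₀ (Over.mk p)
    let u₁ : Z ⟶ Over.mk w := m ≫ k₁ ≫ Over.homMk g₁
    let u₂ : Z ⟶ Over.mk w := m ≫ k₂ ≫ Over.homMk g₂
    obtain ⟨σ, hσ⟩ := X.exists_overIso_hom_comp_eq hZ u₂ u₁
    refine ⟨Z.left, ⟨s.left⟩, m.left ≫ k₁.left, m.left ≫ k₂.left, σ.hom.left, ?_⟩
    have h' := congrArg CommaMorphism.left hσ
    simp only [u₁, u₂, Over.comp_left, Over.homMk_left] at h'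
    simp only [Category.assoc]
    exact h'

/-! ### §5 Consequences with ZERO hypotheses: every `𝕏'` finite étale over a curve of type `(0, r ≥ 3)`
or `(1, r ≥ 1)` — in particular IUT's `X̲_v`, `X̲→_v` over the once-punctured elliptic curve `X_v` -/

/-- ★★ **Every finite étale cover `𝕏'` of a once-punctured elliptic curve**: «objects of `EA` mapping to
`𝕏'`» is id-rigid, UNCONDITIONALLY (gen 4's `isIdRigid_mapsTo_of_isPuncturedEllipticCurve` inherited
along `p`).  This covers IUT's archimedean curves `X̲_v` (type `(1, l)`) and `X̲→_v` (type
`(1, l-tors→)`, of genus `> 1`) of [IUTchI] §1 / Ex 3.4 (i), both finite étale over `X_v = E_v ∖ {0}`.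
[cite: MochizukiAbsTopIII2015, Proposition 4.2 (i) p.106] [cite: Mochizuki2012, Ex 3.4 (i) p.80] -/
theorem isIdRigid_mapsTo_of_hom_of_isPuncturedEllipticCurve {X X' : HolRS} (p : X' ⟶ X)
    (hX : TorsionPointsDenseUniqueGroupLaw.IsPuncturedEllipticCurve X.carrier) :
    IsIdRigid (ObjectProperty.FullSubcategory fun Y : HolRS => Nonempty (Y ⟶ X')) :=
  isIdRigid_mapsTo_of_hom p (X.isIdRigid_mapsTo_of_isPuncturedEllipticCurve hX)

/-- ★★ **Every finite étale cover of a complex torus minus a non-empty finite set** (`E ∖ S`, all types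
`(1, r)`): «objects of `EA` mapping to `𝕏'`» is id-rigid, unconditionally (gen 5's
`isIdRigid_mapsTo_complexTorus_compl_finite` inherited). [cite: MochizukiAbsTopIII2015, Proposition 4.2 (i) p.106] -/
theorem isIdRigid_mapsTo_of_hom_complexTorus_compl_finite (Φ : (Fin 2 → ℝ) ≃L[ℝ] ℂ)
    {S : Set (ComplexTorus Φ)} (hS : S.Finite) (hne : S.Nonempty) {X' : HolRS}
    (p : X' ⟶ ofOpens (M := ComplexTorus Φ) ⟨Sᶜ, hS.isClosed.isOpen_compl⟩
      (isConnected_complexTorus_compl_finite Φ hS hne)) :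
    IsIdRigid (ObjectProperty.FullSubcategory fun Y : HolRS => Nonempty (Y ⟶ X')) :=
  isIdRigid_mapsTo_of_hom p (isIdRigid_mapsTo_complexTorus_compl_finite Φ hS hne)

/-- ★★ **Every finite étale cover of `ℂ ∖ F`** (`F` finite, `|F| ≥ 2`; all types `(0, r ≥ 3)` and their
covers of every genus): «objects of `EA` mapping to `𝕏'`» is id-rigid, unconditionally (abc-iut-L4-t12's
`isIdRigid_mapsTo_planeComplFinite` inherited). [cite: MochizukiAbsTopIII2015, Proposition 4.2 (i) p.106] -/
theorem isIdRigid_mapsTo_of_hom_planeComplFinite {F : Set ℂ} (hF : F.Finite) {p₁ p₂ : ℂ}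
    (hp₁ : p₁ ∈ F) (hp₂ : p₂ ∈ F) (hp : p₁ ≠ p₂) {X' : HolRS} (p : X' ⟶ planeComplFinite F hF) :
    IsIdRigid (ObjectProperty.FullSubcategory fun Y : HolRS => Nonempty (Y ⟶ X')) :=
  isIdRigid_mapsTo_of_hom p (isIdRigid_mapsTo_planeComplFinite hF hp₁ hp₂ hp)

/-- The inheritance inside `EA^hol_RS(Q)` for any cover-closed object property `Q` of `HolRS` (abc-iut-L4-t12's
`isIdRigid_mapsTo_fullSubcategory_iff`). [cite: MochizukiAbsTopIII2015, Proposition 4.2 (i) p.106] -/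
theorem isIdRigid_mapsTo_fullSubcategory_of_hom (Q : ObjectProperty HolRS) (hQ : IsCoverClosed Q)
    {X X' : HolRS} (p : X' ⟶ X) (hX'Q : Q X')
    (h : IsIdRigid (ObjectProperty.FullSubcategory fun Y : HolRS => Nonempty (Y ⟶ X))) :
    IsIdRigid (ObjectProperty.FullSubcategory fun Y : Q.FullSubcategory =>
      Nonempty (Y ⟶ ⟨X', hX'Q⟩)) :=
  (isIdRigid_mapsTo_fullSubcategory_iff Q hQ ⟨X', hX'Q⟩).2 (isIdRigid_mapsTo_of_hom p h)

/-- **`EA^hol_RS(Q_{𝕏'})` is id-rigid and [AbsTopIII] Cor 4.5 (i)–(v) holds over it, for every `𝕏'`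
finite étale over an `𝕏` with «mapsTo `𝕏`» id-rigid** (`cor_4_5_geometric`).
[cite: MochizukiAbsTopIII2015, Corollary 4.5 pp.107–109] -/
theorem cor_4_5_geometric_mapsTo_of_hom {X X' : HolRS} (p : X' ⟶ X)
    (h : IsIdRigid (ObjectProperty.FullSubcategory fun Y : HolRS => Nonempty (Y ⟶ X))) :
    AbsTopIII.Cor_4_5
      (archLogFrobeniusData (geometricAutHolFieldFunctor (fun Y : HolRS => Nonempty (Y ⟶ X'))))
      (archTelecoreData (geometricAutHolFieldFunctor (fun Y : HolRS => Nonempty (Y ⟶ X')))) :=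
  cor_4_5_geometric _ ⟨X', ⟨𝟙 X'⟩⟩ (isIdRigid_mapsTo_of_hom p h)

/-- ★★ **[AbsTopIII] Cor 4.5 (i)–(v) over `EA^hol_RS(Q_{𝕏'})` for every finite étale cover `𝕏'` of a
once-punctured elliptic curve** — e.g. IUT's `X̲_v`, `X̲→_v` — with no residual hypothesis.
[cite: MochizukiAbsTopIII2015, Corollary 4.5 pp.107–109] [cite: Mochizuki2012, Ex 3.4 (i) p.80] -/
theorem cor_4_5_geometric_mapsTo_of_hom_of_isPuncturedEllipticCurve {X X' : HolRS} (p : X' ⟶ X)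
    (hX : TorsionPointsDenseUniqueGroupLaw.IsPuncturedEllipticCurve X.carrier) :
    AbsTopIII.Cor_4_5
      (archLogFrobeniusData (geometricAutHolFieldFunctor (fun Y : HolRS => Nonempty (Y ⟶ X'))))
      (archTelecoreData (geometricAutHolFieldFunctor (fun Y : HolRS => Nonempty (Y ⟶ X')))) :=
  cor_4_5_geometric_mapsTo_of_hom p (X.isIdRigid_mapsTo_of_isPuncturedEllipticCurve hX)

end HolRS

end Literature.AnabelianGeometry.AbsoluteAnabelian

end
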